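import Summits.KontsevichZagierPeriods.KontsevichZagierPeriods.Theorems.TorsionLogsNeronTorsionFlexRealSigma

/-!
# The real quasi-period as the regular integral of the second kind (Néron duplication, part 2)

Support file for the crux `TorsionLogs.NeronTorsionFlex` (stmt-KontsevichZagierPeriods-13806),
line `NeronDuplication`. The rung's product representations `rU`, `rP` carry the factor
`∫_{e₁}^{∞} (g₂x + 2g₃)/(2x²√f(x)) dx` (`f = 4x³ − g₂x − g₃`, `e₁ > 0` the largest root), the
absolutely convergent form of the quasi-period integral `−2∫ x dx/y` regularised at infinity by
`d(y/x)`. For the real lattice `Λ` with invariants `g₂, g₃` (least positive real period `Ω₀`,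
`X = ℘|ℝ`, `Y = ℘′|ℝ`, `e₁ = X(Ω₀/2)`) we prove

* `integral_quasiPeriodDensity_eq` :
  `∫_{e₁}^{∞} (g₂x + 2g₃)/(2x²√f) dx = Re η(Ω₀) = 2 Re ζ(Ω₀/2)`.

Proof: substitute `x = X(v)`, `v ∈ (0, Ω₀/2)` (`dx/√f = −dv`); the integrand becomes
`K(v) = (g₂X + 2g₃)/(2X²)`, which is the derivative of `M(v) = Y/X + 2 Re ζ(v)`
(`Y′ = 6X² − g₂/2`, `Y² = f(X)`, `ζ′ = −℘`); `M(Ω₀/2) = 2 Re ζ(Ω₀/2)` (`Y(Ω₀/2) = 0`) and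
`M(v) → 0` as `v → 0⁺`, because `℘′/℘ + 2ζ = (z²℘′₀ + 2z℘₀)/(z²℘₀ + 1) + 2P′/P` with
`℘₀ = ℘ − 1/z²`, `℘′₀ = ℘′ + 2/z³` analytic and vanishing at `0` (Mathlib's `℘[L - 0]`, `℘'[L - 0]`)
and `P = σ(z)/z` the even entire cofactor of `σ` (`P(0) = 1`, `P′(0) = 0`). Finally
`η(Ω₀) = 2ζ(Ω₀/2)` (`Ω₀ = mω₁ + nω₂`, both sides `= mη₁ + nη₂`).

References: Whittaker–Watson (1927) §§20.4–20.42; Lawden (1989) §6.12–6.13.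
-/

-- single-conjunct summit: Sub = Summit, so the namespace segment repeats by design (CONVENTIONS §2)
set_option linter.dupNamespace false

noncomputable section

open Set MeasureTheory Filter Topology Complex
open scoped PeriodPair

namespace Summit.KontsevichZagierPeriods.KontsevichZagierPeriods.TorsionLogs.NeronDuplication

variable {L : PeriodPair}

/-! ### The cofactor `P = σ/z` and the regular part of `ζ` at the origin -/

/-- The entire cofactor `P(z) = ∏ (1 − z/l)e^{z/l + z²/(2l²)}` of `σ(z) = z·P(z)` is even (from the
oddness of `σ`). [folklore] -/
theorem tprod_sigmaFactor_neg (z : ℂ) :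
    ∏' l : L.lattice, PeriodPair.sigmaFactor (-z) l = ∏' l : L.lattice, PeriodPair.sigmaFactor z l := by
  by_cases hz : z = 0
  · subst hz; simp
  · have h := L.weierstrassSigma_neg z
    change (-z) * ∏' l : L.lattice, PeriodPair.sigmaFactor (-z) l =
      -(z * ∏' l : L.lattice, PeriodPair.sigmaFactor z l) at h
    have h' : z * ∏' l : L.lattice, PeriodPair.sigmaFactor (-z) l =
        z * ∏' l : L.lattice, PeriodPair.sigmaFactor z l := by linear_combination -h
    exact mul_left_cancel₀ hz h'

/-- `P′(0) = 0` for the even entire cofactor `P` of `σ`. [folklore] -/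
theorem deriv_tprod_sigmaFactor_zero :
    deriv (fun z : ℂ => ∏' l : L.lattice, PeriodPair.sigmaFactor z l) 0 = 0 := by
  set P : ℂ → ℂ := fun z => ∏' l : L.lattice, PeriodPair.sigmaFactor z l with hP
  have hPd : Differentiable ℂ P := L.differentiable_tprod_sigmaFactor
  have heven : (fun z => P (-z)) = P := by
    funext z
    simp only [hP]
    exact tprod_sigmaFactor_neg z
  have h1 : deriv (fun z => P (-z)) 0 = -deriv P 0 := by
    rw [deriv_comp_neg]
    simp
  rw [heven] at h1
  have : deriv P 0 = 0 := by linear_combination h1 / 2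
  exact this

/-- `ζ(z) − 1/z = P′(z)/P(z)` off the lattice (`σ = zP`, `σ′/σ = ζ`). [folklore] -/
theorem weierstrassZeta_sub_inv_eq {z : ℂ} (hz : z ∉ L.lattice) :
    L.weierstrassZeta z - 1 / z =
      deriv (fun w : ℂ => ∏' l : L.lattice, PeriodPair.sigmaFactor w l) z /
        ∏' l : L.lattice, PeriodPair.sigmaFactor z l := by
  set P : ℂ → ℂ := fun w => ∏' l : L.lattice, PeriodPair.sigmaFactor w l with hP
  have hz0 : z ≠ 0 := by rintro rfl; exact hz (zero_mem _)
  have hPz : P z ≠ 0 := L.tprod_sigmaFactor_ne_zero hz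
  have hPd : Differentiable ℂ P := L.differentiable_tprod_sigmaFactor
  have hσ : L.weierstrassSigma = fun w => id w * P w := by
    funext w; rfl
  have hlog := L.logDeriv_weierstrassSigma_holds z hz
  rw [hσ, logDeriv_mul z (by simpa using hz0) hPz differentiableAt_id (hPd z), logDeriv_id,
    logDeriv_apply] at hlog
  linear_combination -hlog

/-! ### The limit `℘′/℘ + 2ζ → 0` at the origin along the real axis -/

/-- For a real lattice, `Y(v)/X(v) + 2 Re ζ(v) → 0` as `v → 0⁺`
(`℘′/℘ + 2ζ = (z²℘′₀ + 2z℘₀)/(z²℘₀ + 1) + 2P′/P → 0`). [folklore] -/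
theorem tendsto_derivWeierstrassPRe_div_add (hR : L.IsReal) :
    Tendsto (fun v : ℝ => L.derivWeierstrassPRe v / L.weierstrassPRe v + 2 * (L.weierstrassZeta v).re)
      (𝓝[>] 0) (𝓝 0) := by
  have hΩ := hR.minRealPeriod_pos
  set P : ℂ → ℂ := fun w => ∏' l : L.lattice, PeriodPair.sigmaFactor w l with hP
  have hPd : Differentiable ℂ P := L.differentiable_tprod_sigmaFactor
  set A : ℂ → ℂ := L.weierstrassPExcept 0 with hA
  set B : ℂ → ℂ := L.derivWeierstrassPExcept 0 with hB
  -- the regular expression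
  set Ψ : ℂ → ℂ := fun z => (z ^ 2 * B z + 2 * z * A z) / (z ^ 2 * A z + 1) + 2 * (deriv P z / P z)
    with hΨ
  have hAc : ContinuousAt A 0 := (L.analyticAt_weierstrassPExcept 0).continuousAt
  have hBc : ContinuousAt B 0 := (L.analyticAt_derivWeierstrassPExcept 0).continuousAt
  have hPc : ContinuousAt P 0 := (hPd 0).continuousAt
  have hP'c : ContinuousAt (deriv P) 0 := ((hPd.analyticAt 0).deriv).continuousAt
  have hA0 : A 0 = 0 := L.weierstrassPExcept_zero 0
  have hB0 : B 0 = 0 := L.derivWeierstrassPExcept_zero_zero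
  have hP0 : P 0 = 1 := L.tprod_sigmaFactor_zero
  have hP'0 : deriv P 0 = 0 := deriv_tprod_sigmaFactor_zero
  have hΨc : ContinuousAt Ψ 0 := by
    simp only [hΨ]
    refine ContinuousAt.add ?_ ?_
    · refine ContinuousAt.div (by fun_prop) (by fun_prop) ?_
      rw [hA0]; norm_num
    · exact (hP'c.div hPc (by rw [hP0]; norm_num)).const_mul 2
  have hΨ0 : Ψ 0 = 0 := by
    simp only [hΨ, hA0, hB0, hP0, hP'0]
    norm_num
  -- `Re Ψ(v) → 0` as `v → 0⁺`
  have hlim : Tendsto (fun v : ℝ => (Ψ v).re) (𝓝[>] 0) (𝓝 0) := by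
    have h1 : Tendsto (fun v : ℝ => Ψ v) (𝓝 0) (𝓝 (Ψ 0)) :=
      hΨc.tendsto.comp (by simpa using Complex.continuous_ofReal.tendsto 0)
    rw [hΨ0] at h1
    have h2 := (Complex.continuous_re.tendsto 0).comp h1
    simp only [Complex.zero_re] at h2
    exact h2.mono_left nhdsWithin_le_nhds
  -- near `0⁺` the two functions agree (`X v > 0` there, so `℘(v) ≠ 0`)
  refine hlim.congr' ?_
  have hmem : Ioo 0 (L.minRealPeriod / 2) ∈ 𝓝[>] (0 : ℝ) := Ioo_mem_nhdsGT (by positivity)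
  have hbig : ∀ᶠ v : ℝ in 𝓝[>] 0, 0 < L.weierstrassPRe v :=
    PeriodPair.tendsto_weierstrassPRe_nhdsGT_zero.eventually (eventually_gt_atTop 0)
  filter_upwards [hmem, hbig] with v hv hXpos
  have hv' : (v : ℂ) ∉ L.lattice := hR.ofReal_notMem_lattice hv.1 (by linarith [hv.2])
  have hv0 : (v : ℂ) ≠ 0 := by exact_mod_cast hv.1.ne'
  have hPz : P v ≠ 0 := L.tprod_sigmaFactor_ne_zero hv'
  have h℘ : ℘[L] v ≠ 0 := by
    rw [← hR.ofReal_weierstrassPRe]; exact_mod_cast hXpos.ne'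
  have hAz : A v = ℘[L] v - 1 / (v : ℂ) ^ 2 := by
    have h := L.weierstrassPExcept_def ⟨0, zero_mem _⟩ v
    simp only [sub_zero] at h
    rw [hA, h]; simp; ring
  have hBz : B v = ℘'[L] v + 2 / (v : ℂ) ^ 3 := by
    have h := L.derivWeierstrassPExcept_def ⟨0, zero_mem _⟩ v
    simp only [sub_zero] at h
    rw [hB, h]
  have hζ : L.weierstrassZeta v = 1 / (v : ℂ) + deriv P v / P v := by
    have h := weierstrassZeta_sub_inv_eq hv'
    linear_combination h
  have hden : (v : ℂ) ^ 2 * (℘[L] v - 1 / (v : ℂ) ^ 2) + 1 = (v : ℂ) ^ 2 * ℘[L] v := by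
    field_simp; ring
  have key : Ψ v = ℘'[L] v / ℘[L] v + 2 * L.weierstrassZeta v := by
    simp only [hΨ]
    rw [hAz, hBz, hζ, hden]
    field_simp
    ring
  have h2 : ((2 : ℂ) * L.weierstrassZeta v).re = 2 * (L.weierstrassZeta v).re := by
    simp [Complex.mul_re]
  rw [key, ← hR.ofReal_weierstrassPRe, ← hR.ofReal_derivWeierstrassPRe, ← Complex.ofReal_div,
    Complex.add_re, Complex.ofReal_re, h2]


/-! ### The primitive `M = Y/X + 2 Re ζ` of `K = (g₂X + 2g₃)/(2X²)` -/

/-- On `(0, Ω₀)` where `X ≠ 0`: `(Y/X + 2 Re ζ)′ = (g₂X + 2g₃)/(2X²)` (from `X′ = Y`,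
`Y′ = 6X² − g₂/2`, `Y² = 4X³ − g₂X − g₃`, `ζ′ = −℘`). [folklore] -/
theorem hasDerivAt_quasiPeriodPrimitive (hR : L.IsReal) {v : ℝ} (hv : v ∈ Ioo 0 L.minRealPeriod)
    (hX : L.weierstrassPRe v ≠ 0) :
    HasDerivAt (fun s : ℝ => L.derivWeierstrassPRe s / L.weierstrassPRe s + 2 * (L.weierstrassZeta s).re)
      ((L.g₂.re * L.weierstrassPRe v + 2 * L.g₃.re) / (2 * L.weierstrassPRe v ^ 2)) v := by
  have hv' : (v : ℂ) ∉ L.lattice := hR.ofReal_notMem_lattice hv.1 hv.2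
  have hX' := PeriodPair.hasDerivAt_weierstrassPRe hv'
  have hY' := Summit.KontsevichZagierPeriods.KontsevichZagierPeriods.Cruxes.NeronTorsionSector.Translation.hasDerivAt_derivWeierstrassPRe hR hv'
  have hζ' := hasDerivAt_re_weierstrassZeta (L := L) hv'
  have hsq := hR.derivWeierstrassPRe_sq hv'
  have h := (hY'.div hX' hX).add (hζ'.const_mul 2)
  refine h.congr_deriv ?_
  field_simp
  nlinarith [hsq]

/-! ### The quasi-period integral -/

open Summit.KontsevichZagierPeriods.KontsevichZagierPeriods.Cruxes.NeronTorsionSector.Translation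
  (derivWeierstrassPRe_half weierstrassPRe_half_lt)

/-- **`∫₀^{Ω₀/2} (g₂X + 2g₃)/(2X²) dv = 2 Re ζ(Ω₀/2)`** when `e₁ = X(Ω₀/2) > 0` (fundamental theorem
of calculus for `M = Y/X + 2 Re ζ` on `(0, Ω₀/2)` with `M(0⁺) = 0`, `M(Ω₀/2) = 2 Re ζ(Ω₀/2)`).
[folklore] -/
theorem integral_quasiPeriodDensity_param (hR : L.IsReal)
    (he₁ : 0 < L.weierstrassPRe (L.minRealPeriod / 2)) :
    ∫ v in Ioo 0 (L.minRealPeriod / 2),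
        (L.g₂.re * L.weierstrassPRe v + 2 * L.g₃.re) / (2 * L.weierstrassPRe v ^ 2) =
      2 * (L.weierstrassZeta ((L.minRealPeriod / 2 : ℝ) : ℂ)).re := by
  have hΩ := hR.minRealPeriod_pos
  set T := L.minRealPeriod / 2 with hT
  have hT0 : 0 < T := by positivity
  have hXpos : ∀ v ∈ Ioo 0 T, 0 < L.weierstrassPRe v := fun v hv =>
    he₁.trans (weierstrassPRe_half_lt hR ⟨hv.1, by rw [hT] at hv; linarith [hv.2]⟩ (by
      rw [hT] at hv; exact hv.2.ne))
  have hnot : ∀ v ∈ Ioc 0 T, (v : ℂ) ∉ L.lattice := fun v hv =>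
    hR.ofReal_notMem_lattice hv.1 (by rw [hT] at hv; linarith [hv.2])
  -- derivative on the open interval
  have hderiv : ∀ v ∈ Ioo 0 T, HasDerivAt
      (fun s : ℝ => L.derivWeierstrassPRe s / L.weierstrassPRe s + 2 * (L.weierstrassZeta s).re)
      ((L.g₂.re * L.weierstrassPRe v + 2 * L.g₃.re) / (2 * L.weierstrassPRe v ^ 2)) v := fun v hv =>
    hasDerivAt_quasiPeriodPrimitive hR ⟨hv.1, by rw [hT] at hv; linarith [hv.2]⟩ (hXpos v hv).ne'
  -- integrability: the integrand is continuous and bounded on `(0, T)`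
  have hcont : ContinuousOn (fun v : ℝ =>
      (L.g₂.re * L.weierstrassPRe v + 2 * L.g₃.re) / (2 * L.weierstrassPRe v ^ 2)) (Ioo 0 T) := by
    intro v hv
    have hc : ContinuousAt L.weierstrassPRe v :=
      PeriodPair.continuousAt_weierstrassPRe (hnot v ⟨hv.1, hv.2.le⟩)
    have hX0 : (2 : ℝ) * L.weierstrassPRe v ^ 2 ≠ 0 := by positivity [(hXpos v hv).ne']
    exact (((continuousAt_const.mul hc).add continuousAt_const).div
      (continuousAt_const.mul (hc.pow 2)) hX0).continuousWithinAt
  have hbound : ∀ v ∈ Ioo 0 T, ‖(L.g₂.re * L.weierstrassPRe v + 2 * L.g₃.re) /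
      (2 * L.weierstrassPRe v ^ 2)‖ ≤ |L.g₂.re| / (2 * L.weierstrassPRe T) +
        |L.g₃.re| / L.weierstrassPRe T ^ 2 := by
    intro v hv
    have hX := hXpos v hv
    have hXe : L.weierstrassPRe T ≤ L.weierstrassPRe v :=
      (weierstrassPRe_half_lt hR ⟨hv.1, by rw [hT] at hv; linarith [hv.2]⟩
        (by rw [hT] at hv; exact hv.2.ne)).le
    rw [Real.norm_eq_abs, abs_div, abs_of_pos (by positivity : (0:ℝ) < 2 * L.weierstrassPRe v ^ 2)]
    have h1 : |L.g₂.re * L.weierstrassPRe v + 2 * L.g₃.re| ≤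
        |L.g₂.re| * L.weierstrassPRe v + 2 * |L.g₃.re| := by
      calc |L.g₂.re * L.weierstrassPRe v + 2 * L.g₃.re|
          ≤ |L.g₂.re * L.weierstrassPRe v| + |2 * L.g₃.re| := abs_add_le _ _
        _ = |L.g₂.re| * L.weierstrassPRe v + 2 * |L.g₃.re| := by
          rw [abs_mul, abs_of_pos hX, abs_mul, abs_of_pos (by norm_num : (0:ℝ) < 2)]
    rw [div_le_iff₀ (by positivity)]
    have h2 : |L.g₂.re| * L.weierstrassPRe v ≤
        |L.g₂.re| / (2 * L.weierstrassPRe T) * (2 * L.weierstrassPRe v ^ 2) := by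
      rw [div_mul_eq_mul_div, le_div_iff₀ (by positivity)]
      have : L.weierstrassPRe v * L.weierstrassPRe T ≤ L.weierstrassPRe v * L.weierstrassPRe v :=
        mul_le_mul_of_nonneg_left hXe hX.le
      nlinarith [abs_nonneg L.g₂.re]
    have h3 : 2 * |L.g₃.re| ≤ |L.g₃.re| / L.weierstrassPRe T ^ 2 * (2 * L.weierstrassPRe v ^ 2) := by
      rw [div_mul_eq_mul_div, le_div_iff₀ (by positivity)]
      have : L.weierstrassPRe T ^ 2 ≤ L.weierstrassPRe v ^ 2 := by
        exact pow_le_pow_left₀ he₁.le hXe 2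
      nlinarith [abs_nonneg L.g₃.re]
    linarith
  have hint : IntegrableOn (fun v : ℝ =>
      (L.g₂.re * L.weierstrassPRe v + 2 * L.g₃.re) / (2 * L.weierstrassPRe v ^ 2)) (Ioo 0 T) := by
    refine Integrable.mono' (g := fun _ => |L.g₂.re| / (2 * L.weierstrassPRe T) +
        |L.g₃.re| / L.weierstrassPRe T ^ 2) (integrableOn_const (by simp))
      (hcont.aestronglyMeasurable measurableSet_Ioo) ?_
    exact (ae_restrict_iff' measurableSet_Ioo).mpr (Eventually.of_forall hbound)
  -- limits at the endpoints
  have hlim0 := tendsto_derivWeierstrassPRe_div_add hR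
  have hlimT : Tendsto
      (fun s : ℝ => L.derivWeierstrassPRe s / L.weierstrassPRe s + 2 * (L.weierstrassZeta s).re)
      (𝓝[<] T) (𝓝 (2 * (L.weierstrassZeta ((T : ℝ) : ℂ)).re)) := by
    have hTn : ((T : ℝ) : ℂ) ∉ L.lattice := hnot T ⟨hT0, le_rfl⟩
    have hc : ContinuousAt
        (fun s : ℝ => L.derivWeierstrassPRe s / L.weierstrassPRe s + 2 * (L.weierstrassZeta s).re) T :=
      ((PeriodPair.continuousAt_derivWeierstrassPRe hTn).div (PeriodPair.continuousAt_weierstrassPRe hTn)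
        he₁.ne').add ((hasDerivAt_re_weierstrassZeta (L := L) hTn).continuousAt.const_mul 2)
    have h := hc.tendsto
    rw [show L.derivWeierstrassPRe T = 0 from derivWeierstrassPRe_half hR, zero_div, zero_add] at h
    exact h.mono_left nhdsWithin_le_nhds
  have key := intervalIntegral.integral_eq_sub_of_hasDerivAt_of_tendsto hT0 hderiv
    ((intervalIntegrable_iff_integrableOn_Ioo_of_le hT0.le).mpr hint) hlim0 hlimT
  rw [intervalIntegral.integral_of_le hT0.le, integral_Ioc_eq_integral_Ioo, sub_zero] at key
  exact key

/-- **The real quasi-period as an absolutely convergent integral of the second kind**: for a real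
lattice whose largest real root `e₁ = X(Ω₀/2)` of `f = 4x³ − g₂x − g₃` is positive,
`∫_{e₁}^{∞} (g₂x + 2g₃)/(2x²√f(x)) dx = 2 Re ζ(Ω₀/2)` (`= Re η(Ω₀)`; substitution `x = X(v)`,
`v ∈ (0, Ω₀/2)`, then `integral_quasiPeriodDensity_param`; Lawden §6.13, Whittaker–Watson §20.41).
[folklore] -/
theorem integral_quasiPeriodDensity_eq (hR : L.IsReal)
    (he₁ : 0 < L.weierstrassPRe (L.minRealPeriod / 2)) :
    ∫ x in Ioi (L.weierstrassPRe (L.minRealPeriod / 2)),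
        (L.g₂.re * x + 2 * L.g₃.re) / (2 * x ^ 2 * Real.sqrt (4 * x ^ 3 - L.g₂.re * x - L.g₃.re)) =
      2 * (L.weierstrassZeta ((L.minRealPeriod / 2 : ℝ) : ℂ)).re := by
  have hΩ := hR.minRealPeriod_pos
  have hanti := hR.strictAntiOn_weierstrassPRe
  have hnot : ∀ s ∈ Ioo 0 (L.minRealPeriod / 2), (s : ℂ) ∉ L.lattice :=
    fun s hs ↦ hR.ofReal_notMem_lattice hs.1 (by linarith [hs.2])
  have hinj : InjOn L.weierstrassPRe (Ioo 0 (L.minRealPeriod / 2)) :=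
    hanti.injOn.mono Ioo_subset_Ioc_self
  rw [← hR.image_weierstrassPRe_Ioo, integral_image_eq_integral_abs_deriv_smul measurableSet_Ioo
    (fun s hs ↦ (PeriodPair.hasDerivAt_weierstrassPRe (hnot s hs)).hasDerivWithinAt) hinj,
    ← integral_quasiPeriodDensity_param hR he₁]
  refine setIntegral_congr_fun measurableSet_Ioo fun s hs => ?_
  simp only [smul_eq_mul]
  have hY : L.derivWeierstrassPRe s ≠ 0 := (hR.derivWeierstrassPRe_neg hs.1 (by linarith [hs.2])).ne
  have hX : L.weierstrassPRe s ≠ 0 :=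
    (he₁.trans (weierstrassPRe_half_lt hR ⟨hs.1, by linarith [hs.2]⟩ hs.2.ne)).ne'
  rw [← hR.derivWeierstrassPRe_sq (hnot s hs), Real.sqrt_sq_eq_abs]
  field_simp

end Summit.KontsevichZagierPeriods.KontsevichZagierPeriods.TorsionLogs.NeronDuplication

end
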